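import Mathlib
import HarnessLib
import HarnessLib.Audit
import Summits.AtomisticToContinuum.Statement
import Literature.MathematicalPhysics.KineticTheory.NewtonianFlow
import Summits.AtomisticToContinuum.FouriersLaw.Theorems.EmbeddedDrudeMourreNessUnique
import Summits.AtomisticToContinuum.FouriersLaw.Theorems.ContactEchoEpochsPinnedSteadyStateExists
import HarnessLib.Audit.Status.Attr

/-!
Route: AffineAnchorRing

DORMANT since 2026-08-25T04:41:54Z (reconciler: no traction for 7.4 d (last activity item-evidence-added at 2026-08-17T19:01:27Z); parked, not closed — `ledger route dormant route-AtomisticToContinuum-AffineAnchorRing --off` to reactiva) — unstaffed, not closed; items shared with open routes are served there. `ledger route dormant <id> --off` reactivates.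

# Route AffineAnchorRing — affine-group symmetry types the anchor's spectrum; Fourier at the anchor
= ring Drude decay + regular DC limit

X_AAR (AFFINE ANCHOR, RING INTERFACE; conforming re-filing of the retired route AffineAnchor,
realises idea card
affine-group-anchor-spectral-type). Work on the conjunct's scale-free anchor — the CLOSED
homogeneous quartic RING
H = Σp²/2 + μΣq⁴/4 + Σ_bonds r⁴/4 (μ = lam/β > 0) at Gibbs temperature T, current autocorrelation
C_N(t) = E_T[J_N(Φ_t·)J_N].
It suffices to show X = K1 ∧ C1 ∧ C2 ∧ K3 ∧ X_SFQA: (K1 AnchorSpectralType, theorem-grade) the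
dilations (q,p) ↦ (aq,a²p)
conjugate the flow to all its time-rescalings, so every spectral measure is an atom at 0 plus an
ABSOLUTELY CONTINUOUS part and
C_N(t) → D_N := ‖E_T[J_N|ℐ]‖² (relative mixing, no chaos input); (C1 RingDrudeDecay) the finite-N
Drude atom per site vanishes,
D_N/N → 0 — the NECESSARY half (support AtomBoundByAbelMean: D_N/N ≤ ε·a_N(ε) for every Abel mean
a_N); (C2
AnchorRegularConductivity) given C1, the regular part has a thermodynamic-then-DC limit k(μ,T) > 0;
(K3 AnchorKuboFourier)
ring Green–Kubo ⇒ BLR responses of the bath-driven anchor converge to k/T²; X_SFQA = EtaContinuation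
∧ LowTClosure (shared
verbatim with PorousMediumCorner / ScaleFreeQuarticAnchor) carries the anchor's law to pinnedChain
at every T.
Lean: `AnchorSpectralType → AnchorCurrentMemLp → AnchorFlow → RingDrudeDecay →
AnchorRegularConductivity → DrudeRegularGlue → AnchorFiniteResponse → AnchorKuboFourier → AnchorNess
→ EtaContinuation → LowTClosure → NessUnique → PinnedSteadyStateExists → FouriersLaw`

## Assembly
Bookkeeping; the DECIDING THEOREM `closes` (same type as the Assembly item) is sorry-free in the
planner's Sketch.lean (lean check rc 0,
0 warnings, axioms propext / Classical.choice / Quot.sound; 124 lines) and supplied with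
--closes-file. Anchor half, for every μ > 0 and
friction γ > 0: name the ring Hamiltonians/currents once (θ = 1; two one_mul seams), choose the ring
flows from AnchorFlow; for T > 0, K1
at f := J_N (in L² by AnchorCurrentMemLp) gives σ_N, the cos-representation and C_N(t) → D_N :=
σ_N{0}; RingDrudeDecay gives D_N/N → 0;
AnchorRegularConductivity (fed D and the decay) gives k(T) > 0 and K; continuity of C_N and |C_N| ≤
C_N(0) follow from the
cos-representation (dominated convergence, norm_integral_le_of_norm_le_const) and DrudeRegularGlue
upgrades to the full Abel means;
AnchorNess gives pairwise uniqueness, AnchorKuboFourier sends every response sequence of every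
steady-state family to k/T²,
AnchorFiniteResponse supplies the sequences; κ(T) := k(T)/T² (choose). Conjunct: clause (i) from
PinnedSteadyStateExists + NessUnique;
clause (ii): the anchor half at μ = lam/β discharges EtaContinuation's hypothesis for every γ',
LowTClosure extends to all T > 0 —
verbatim the tail of PorousMediumCorner.closes. FreeEndInsulator is a calibration support outside
`closes`.

Rationale: WHY THIS LINE. Mechanical similarity of the anchor (LandauLifshitzMechanics1976 §10: H(aq,a²p) =
a⁴H, Φ_t∘S_a = S_a∘Φ_{at}) makes the
dilations U_a f = a^{3N/2}f∘S_a and the Koopman group V_t a unitary representation of the affine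
group Aff⁺(ℝ) on L²(Liouville),
U_aV_tU_a⁻¹ = V_{at}; the Gelfand–Fomin / Mautner–Moore argument for horocycle flows
(GelfandFomin1952; Tomter in
book:chern1970-global-analysis Prop. 20, PDF p. 389: U(exp(−tα))P(μ)U(exp tα) = P(e^{tλ}μ) ⇒
Lebesgue spectrum; KatokThouvenot2006;
self-similar flows FraczekLemanczyk2009, Ryzhikov2018) then hands over the spectral TYPE of a
non-integrable anharmonic lattice at
every N and T with no estimate, and the unitary f ↦ fρ_T^{1/2} moves it to every Gibbs state
(Bochner is proved in tree,
Literature.Analysis.FunctionSpaces.bochner). Imported areas: unitary representation theory /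
homogeneous dynamics (spectral type
from symmetry); condensed-matter Drude-weight phenomenology made exact at finite N (σ(ω) = Dδ +
σ_reg: HeidrichMeisnerHoneckerCabraBrenig2003,
RigolShastry2008, Mazur1969, in-tree Mazur.tendsto_inv_mul_integral_inner); the Olla-school ring
convention for Green–Kubo
(BernardinOlla2005, BasileBernardinOlla2009: κ = lim_{ε↓0} lim_N of Laplace-transformed ring
correlations). What no open route does:
FourierGreenKubo / OddSectorIrreversibility / BondHeatUncertainty / CurrentTiltQuench work
T-pointwise on pinnedChain;
PorousMediumCorner takes the same anchor corner through the INFINITE-VOLUME bath-free dynamics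
(AnchorAbelGreenKubo); this
line is its finite, CLOSED-RING alternative decomposition with a crux closable today (K1), a
refutable necessary condition (C1,
already probed by MD), and an exact calibration of what finite closed chains can certify (free ends:
GK_N ≡ 0, support
FreeEndInsulator; rings: one chiral atom + an L¹ density). New in this filing (answering the refuter
notes on the first one): C2 is
stated CONDITIONALLY on C1, so that all atom bookkeeping sits in C1 (a parity oscillation of D_N/N
now falsifies C1 only), and the
one-line inequality D_N/N ≤ ε·a_N(ε) (AtomBoundByAbelMean) records that C1 is implied by ANY finite
Abelian ring conductivity.

RANKED CRUXES. #2 AnchorSpectralType (crux) — (card item 1, weak form actually used) For every N, μ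
> 0, wrap strength θ ≥ 0 (θ = 0 free ends, θ = 1 ring), T > 0, the Newtonian flow Φ of H_θ = Σp²/2 +
μΣq⁴/4 + Σ_{i<N-1}(q_{i+1}−q_i)⁴/4 + θ(q_0−q_{N−1})⁴/4 and every f ∈ L²(Gibbs_T): there is a finite
measure σ_f on ℝ with E_T[f(Φ_t·)f] = ∫cos(ωt)dσ_f(ω) for all t, σ_f restricted to ℝ∖{0} absolutely
continuous (no eigenvalues off 0, no singular continuous part), and E_T[f(Φ_t·)f] → σ_f{0} =
‖E_T[f|ℐ]‖² as t → ∞ (relative mixing). Proof: U_a f = a^{3N/2}f∘S_a and V_t are unitary on L²(Leb)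
with U_aV_tU_a⁻¹ = V_{at}; the null ideal of the Bochner measures is dilation-invariant ⇒ (Fubini
over Haar of (ℝ_{>0},·)) every σ_f is a.c. off 0; transfer to L²(Gibbs_T) by f ↦ fρ_T^{1/2};
Riemann–Lebesgue. Verified on paper by the refuters of the first filing (stmt-4901 notes, incl. N =
0, 1). [difficulty: XL] (why it might fail: Mathematically classical (dilation-invariant null ideal
⇒ Lebesgue class off 0; Bochner in tree); the risk is formal, XL: no Stone theorem / maximal
spectral type in Mathlib, and the IsFlow API (uniqueness, Liouville) is global-Lipschitz only — the
cubic field needs truncation.) [GelfandFomin1952, book:chern1970-global-analysis,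
KatokThouvenot2006, FraczekLemanczyk2009, Ryzhikov2018, LandauLifshitzMechanics1976,
KozlovTreshchev2003, Mazur1969]
#3 AnchorRegularConductivity (crux) — (card (C2) AnchorDensity, Abel / thermodynamic-limit-first
form, CONDITIONAL ON C1) RING (θ = 1), every μ, T > 0, with J_N = Σ_bonds
−½(p_i+p_{i+1})(q_{i+1}−q_i)³ (wrap bond included), C_N(t) = E_T[J_N(Φ_t·)J_N], D_N = lim_t C_N(t)
(supplied by AnchorSpectralType) AND D_N/N → 0 (RingDrudeDecay, now a hypothesis): the REGULAR part
has a DC limit — ∃ k > 0 and K with N⁻¹∫_0^∞e^{−εt}(C_N(t) − D_N)dt → K(ε) as N → ∞ for every ε > 0,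
and K(ε) → k as ε ↓ 0. The regular mean is N⁻¹∫_{ω≠0} ε/(ε²+ω²)g_N(ω)dω, g_N the L¹ density of
σ_{J_N} off 0 (K1); content = (A) N → ∞ at fixed ε (classical-hard: ring locality + infinite-volume
dynamics + propagation bounds) and (B) ε ↓ 0 with 0 < k < ∞, the transport problem; κ₀(T) = k/T²,
k(μ,T) = T^{9/4}k(μ,1). [deps: AnchorSpectralType, RingDrudeDecay] [difficulty: open-problem] (why
it might fail: (B) is the transport problem at the anchor: no N-uniform control of the a.c. density
g_N near ω = 0 exists for any deterministic anharmonic chain; K(ε) may blow up as ε ↓ 0 (μ → 0 is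
the anomalous quartic FPU chain) or vanish (sticky island hierarchies), although every σ_N is a.c.)
[BonettoLebowitzReyBellet2000, LepriLiviPoliti2003, BernardinOlla2005, BasileBernardinOlla2009,
CanestrariLiveraniOlla2026, LanfordLebowitzLieb1977, doi:10.1007/s10955-007-9278-0,
doi:10.1007/s10955-016-1540-x, decl
Literature.Barriers.AtomisticToContinuum.LukkarinenSpohn2008_lemma41, decl
Literature.Barriers.AtomisticToContinuum.MacroErgodicityBarrier]
#4 RingDrudeDecay (crux) — (card (C1) ChiralIslandDecay) RING, every μ, T > 0: the finite-N Drude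
atom per site vanishes, D_N/N → 0 (D_N = lim_t C_N(t), supplied by AnchorSpectralType). By momentum
reversal Π (ΠJ = −J, Πℐ = ℐ) the atom D_N = ‖E_T[J_N|ℐ]‖² is carried by Π-asymmetric (circulating,
chiral) invariant components only, so the statement says: chiral regular islands have vanishing
Gibbs weight per site — the NECESSARY half of 0 < κ₀ < ∞ on closed chains: by Fubini σ_N{0} ≤
ε∫_0^∞e^{−εt}C_N(t)dt, i.e. D_N/N ≤ ε·a_N(ε) for every full Abel mean, so any finite Abelian ring
conductivity forces it (helper lemma AtomBoundByAbelMean, rides with --supports). MD status: see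
Cheapest falsifier. [deps: AnchorSpectralType] [difficulty: open-problem] (why it might fail: A
positive-measure family of circulating (Π-asymmetric) KAM islands with non-vanishing Gibbs weight
per site gives D_N ≍ N, a ballistic component; mixed phase space, no hyperbolicity, parameter-free
model (no 'generic μ' escape); o(N) uniformly in N is open-problem class, not L.) [Mazur1969,
Suzuki1971, Zotos2002, MackayPercival1985, HeidrichMeisnerHoneckerCabraBrenig2003, RigolShastry2008,
BenentiCasatiMejiaMonasterioPeyrard2016, decl
Literature.Barriers.AtomisticToContinuum.MazurBoundBallisticNarrow]
#5 AnchorKuboFourier (crux) — (κ_BLR = κ_GK at the anchor, ring form; sibling of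
PorousMediumCorner's infinite-volume AnchorThermodynamicLimit stmt-9791) For the OPEN anchor chain
⟨μq⁴/4, r⁴/4, γ⟩ between Langevin baths and T > 0: if for the ring flow family the full Green–Kubo
Abel means converge, N⁻¹∫_0^∞e^{−εt}C_N(t)dt → K(ε) (N → ∞) and K(ε) → k (ε ↓ 0), then, under
pairwise weak-NESS uniqueness, for every steady-state family and every sequence D_N of BLR response
coefficients (D_N(T) = lim_{δ→0} totalCurrent(ν_{N,T+δ/2,T−δ/2})/δ; existence =
AnchorFiniteResponse) one has D_N → k/T² (finite-volume Kubo formula at 0⁺ + N-uniform low-frequency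
control + o(N) contact layers; by ring locality the ring Abel means equal the infinite-volume ones
at fixed ε). [deps: AnchorRegularConductivity, RingDrudeDecay] [difficulty: open-problem] (why it
might fail: κ_BLR = κ_GK is unproved for every Hamiltonian bulk (BLR §7, Dhar §9e); the statement
silently makes the limit independent of the bath coupling γ (the one non-scale-free datum, γ_eff =
γT^{-1/4}): contact layers must be o(N) uniformly, and the open-chain gap closes like γ/N.)
[BonettoLebowitzReyBellet2000, Dhar2008, KunduDharNarayan2009, ReyBellet2003, HairerMajda2009,
CuneoEckmannHairerReyBellet2018, decl Literature.Barriers.AtomisticToContinuum.HasBoundedResponse,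
decl Literature.Barriers.AtomisticToContinuum.BeckerMenegaki2022_gapClosing]
#6 EtaContinuation (crux) — η-CONTINUATION = ANCHOR STABILITY — verbatim the item EtaContinuation of
route PorousMediumCorner (stmt-AtomisticToContinuum-9792, = ScaleFreeQuarticAnchor's stmt-3280;
shared by signature; NOT this card's mechanism): for ω₂, lam, β, γ > 0, IF the anchor at pinning
ratio lam/β has a positive BLR conductivity function for every friction γ' (derived here from K1 +
C1 + C2 + K3 + AnchorNess + AnchorFiniteResponse in `closes`), THEN there is T₁ such that for every
T > T₁ pinnedChain ω₂ lam β γ obeys Fourier's law pointwise at T (pinnedChain at T ≅ anchor(lam/β) +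
η(ω₂Q² + R²)/2 at temperature 1, friction γη^{1/2}, η = (βT)^{−1/2}). [deps: AnchorKuboFourier]
[difficulty: open-problem] (why it might fail: 'Fourier holds' is not known to be an open condition:
hypothesis qualitative (no rate in N, nothing uniform in γ'), conclusion needs N-uniform stability
under the singular perturbation η(ω₂Q²+R²)/2 (well frequency 0→√(ηω₂): ballistic germs in cold
spots) at friction γη^{1/2}; print is fixed-N only.) [AokiLukkarinenSpohn2006, HairerMajda2009,
CuneoEckmannHairerReyBellet2018, DeRoeckHuveneers2015, decl
Literature.Barriers.AtomisticToContinuum.LowTemperatureWeakAnharmonicity, decl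
Literature.Barriers.AtomisticToContinuum.HasBoundedResponse]
#7 LowTClosure (crux) — DOWNWARD CLOSURE IN TEMPERATURE — verbatim the item LowTClosure of route
PorousMediumCorner (stmt-AtomisticToContinuum-9793, = ScaleFreeQuarticAnchor's stmt-3281; shared by
signature; NOT this card's mechanism): for ω₂, lam, β, γ > 0, if pinnedChain ω₂ lam β γ obeys
Fourier's law pointwise at every T above some T₁, then it does so at every T > 0 — propagation down
the coupling ray to the kinetic corner; plug-in point for kinetic-regime routes. [deps:
EtaContinuation] [difficulty: open-problem] (why it might fail: The high-T hypothesis carries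
nothing downward (no monotonicity/analyticity of T ↦ 'Fourier at T' is known), so this IS the
conjunct on (0,T₁], incl. the kinetic corner T→0 ≅ λ→0 where κ ≍ (λT)⁻² is only a 'tentative'
kinetic prediction (ALS2006) and prethermal scales τ₂ ∼ λ^{-2p} appear (HL2020).)
[AokiLukkarinenSpohn2006, HuveneersLukkarinen2020, BricmontKupiainen2007, LefevereSchenkel2006, decl
Literature.Barriers.AtomisticToContinuum.LowTemperatureWeakAnharmonicity, decl
Literature.Barriers.AtomisticToContinuum.AokiLukkarinenSpohn2006_kineticLowTemperature_prediction]
#9 AnchorCurrentMemLp (support) — For every N, μ > 0, θ ≥ 0, T > 0 the tilted measure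
volume.tilted(−H_θ/T) is a probability measure (e^{−H_θ/T} integrable: H_θ ≥ Σp²/2 + μΣq⁴/4) and the
θ-ring current is in L²(Gibbs) (polynomial × Gaussian-in-p × e^{−quartic}). Used by `closes` at θ =
1. Verbatim stmt-4906. [difficulty: provable-now] [BonettoLebowitzReyBellet2000,
CuneoEckmannHairerReyBellet2018]
#9 AnchorFlow (support) — For every N, μ > 0, θ ≥ 0 the Newtonian flow of H_θ exists globally
(energy conservation + coercivity; local Lipschitz uniqueness), conserves H_θ, and preserves
Lebesgue measure (Liouville: truncate the cubic field on a sublevel set,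
NewtonianFlow.IsSolutionFamily.measurePreserving). De-vacuifies the ∀Φ-items. Verbatim stmt-4907.
[difficulty: provable-now] [LanfordLebowitzLieb1977, BonettoLebowitzReyBellet2000, decl
Literature.MathematicalPhysics.KineticTheory.NewtonianFlow.IsFlow]
#9 DrudeRegularGlue (support) — Pure real analysis (verbatim stmt-4908, which carries 13 sorry-free
candidate proofs as evidence — land one): for continuous c_N with |c_N(t)| ≤ c_N(0), c_N(t) → D_N,
D_N/N → 0 and N⁻¹∫_0^∞e^{−εt}(c_N − D_N) → K(ε) for every ε > 0, also N⁻¹∫_0^∞e^{−εt}c_N → K(ε) (the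
atom contributes D_N/(Nε) → 0). Used by `closes` between C1 ∧ C2 and K3. [difficulty: provable-now]
[BenentiCasatiMejiaMonasterioPeyrard2016, folklore]
#9 AnchorFiniteResponse (support) — Verbatim AnchorFiniteResponse of PorousMediumCorner
(stmt-AtomisticToContinuum-9797 = 4909; shared by signature): for μ, γ > 0, under pairwise weak-NESS
uniqueness, for every steady-state family, every T > 0 and N the response limit D_N(T) = lim_{δ→0,
δ≠0} totalCurrent(ν N (T+δ/2) (T−δ/2))/δ exists. [difficulty: L] [ReyBellet2003, HairerMajda2009,
CuneoEckmannHairerReyBellet2018, Carmona2007]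
#9 AnchorNess (support) — Verbatim AnchorNess of PorousMediumCorner (stmt-AtomisticToContinuum-9796
= 4910; shared by signature): for μ, γ > 0, every N and T_L, T_R > 0 the chain ⟨μq⁴/4, r⁴/4, γ⟩ has
a weak steady state and any other coincides with it (CEHR2018 Thm 2.13 applies verbatim: x⁴
non-degenerate by Ex. 2.5, C5 with ℓ_i = ℓ_p = 4; plus the weak-Fokker–Planck identification shared
with NessUnique). [difficulty: L] [CuneoEckmannHairerReyBellet2018, Carmona2007,
EckmannPilletReyBellet1999b, ReyBelletThomas2002]
#9 NessUnique (support) — Uniqueness of the weak steady state of pinnedChain, every N, T_L, T_R > 0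
— verbatim NessUnique (stmt-AtomisticToContinuum-0741, shared by 20+ routes); with
PinnedSteadyStateExists it gives clause (i) in `closes`. [difficulty: L]
[CuneoEckmannHairerReyBellet2018, Carmona2007]
#9 PinnedSteadyStateExists (support) — Clause (i) existence for pinnedChain — verbatim
PinnedSteadyStateExists of PorousMediumCorner (stmt-AtomisticToContinuum-9900; shared): PROVED in
tree (pinnedChain_exists_isSteadyState, LangevinChainNESSHolds.lean); a hypothesis of `closes` so
that the Theses file does not import the Langevin-SDE cone. [difficulty: provable-now]
[CuneoEckmannHairerReyBellet2018, Carmona2007, decl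
Literature.MathematicalPhysics.KineticTheory.HeatConduction.pinnedChain_exists_isSteadyState]
#9 FreeEndInsulator (support) — (card corollary (3), calibration; NOT in `closes`) FREE ENDS (θ =
0), every N, μ, T > 0: J_N = 𝓛G_N with the energy dipole G_N = Σ_x x·h_x, so J_N ⊥ ker 𝓛: C_N(t) → 0
as t → ∞ AND the Abel-regularised finite-N Green–Kubo integral ∫_0^∞e^{−εt}C_N(t)dt → 0 as ε ↓ 0 —
finite free-end chains are exact insulators at ω = 0 (σ_J = ω²σ_G): closed-chain certificates must
live on rings. Verbatim stmt-4911 (theorem-grade given K1). [difficulty: M] [RigolShastry2008,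
Mazur1969, decl Literature.Barriers.AtomisticToContinuum.MazurBoundBallisticNarrow]

TWO-LAYER PLAN. Foreseen glued splits (k ≤ 3, depth 1), filed only when a prover engages:
AnchorSpectralType ⇐ AffineKoopmanRep (flow + Liouville +
dilation covariance: a strongly continuous unitary representation of Aff⁺(ℝ) on L²(Leb) intertwined
with L²(Gibbs)) → DilationClassLemma
(a unitary group conjugate to all its time-dilates has Bochner measures a.c. off 0) →
AnchorSpectralType. RingDrudeDecay ⇐ ChiralSupport (D_N = Σ over pairs (A, ΠA) of
Π-asymmetric invariant sets of 2μ_T(A)(E[J_N1_A]/μ_T(A))²) → IslandWeightDecay (Gibbs weight per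
site of circulating regular components
→ 0; converse KAM at T = 1). AnchorRegularConductivity ⇐ RingLimit (N → ∞ at fixed ε: ring locality
+ infinite-volume dynamics,
LanfordLebowitzLieb1977 / doi:10.1007/s10955-016-1540-x; theorem-grade per refuter g41-48) → DCLimit
(ε ↓ 0, the transport problem). AnchorKuboFourier ⇐ FiniteVolumeKubo (Rey-Bellet Rem 4.4 for the
anchor) → ContactLayer (o(N)).
EtaContinuation / LowTClosure are split, if at all, by the tenure planner of the route that owns
them (shared nodes).

KILL CRITERIA. RingDrudeDecay refuted (an extensive-weight family of circulating islands: D_N ≥ cN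
at some μ, T — MD plateau of C_N(t)/N not decaying
in N, then a converse-KAM / interval certificate) ⇒ by the inequality D_N/N ≤ ε·a_N(ε) no finite
Abelian ring conductivity exists: close
`refuted:RingDrudeDecay`, file ¬AnchorKuboFourier-hypothesis evidence and flag PorousMediumCorner's
AnchorAbelGreenKubo (same corner).
AnchorRegularConductivity refuted with K(ε) → ∞ (anomalous anchor) or → 0 ⇒ close
`refuted:AnchorRegularConductivity` (first-rate
negative result for the conjunct's T → ∞ end). AnchorSpectralType cannot fail mathematically; a
typed-form defect ⇒ restate 1:1, not
close. AnchorKuboFourier refuted (κ_BLR ≠ κ_GK at the anchor, or γ-dependence of the limit) ⇒ shared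
fate with PorousMediumCorner's
AnchorThermodynamicLimit / DrudeMourre 3161 / FourierGreenKubo 0742: keep K1/C1/C2 as the
closed-chain half and pivot the bridge.
EtaContinuation or LowTClosure refuted ⇒ repair follows the owning route's restatement (shared
nodes). FouriersLaw proved elsewhere
moots the route; PorousMediumCorner landing AnchorAbelGreenKubo + AnchorThermodynamicLimit first
supersedes the anchor half here
(then K1/C1/FreeEndInsulator stay wanted as the finite-chain calibration).

NOT DECOMPOSED YET. The engine for DCLimit inside AnchorRegularConductivity (none claimed: the GK
routes' engines — hypocoercive resolvent, corner
continuity, Herglotz bracket — would run at T = 1 on a parameter-free instance); converse-KAM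
certification and the island census
behind RingDrudeDecay (kit work); the o(N) contact-layer estimate inside AnchorKuboFourier; the
children of EtaContinuation / LowTClosure
(owned elsewhere); the scaling-covariance helper k(μ,T) = T^{9/4}k(μ,1) (rides with --supports);
the helper AtomBoundByAbelMean (σ{0} ≤ ε∫e^{−εt}∫cos(ωt)dσ dt, provable now, elaborated in the
planner's Sketch.lean) behind C1's necessity; polarised and L²(Leb) versions of K1; the free-end
singular limit ω²σ_G′(ω)/N at |ω| ≍ N⁻²; all constants (k(μ,1), T₁, contact
resistances).

CHEAPEST FALSIFIER. Canonical MD of the anchor RING, μ = 1, T = 1 (all T are conjugate), N = 8…128: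
C_N(t)/N must settle to a constant D_N/N without
persistent oscillation (K1 is a theorem — else the code is wrong) and D_N/N must fall with N
(RingDrudeDecay); with free ends C_N(t) → 0
and the running GK integral must return to 0 (FreeEndInsulator, an exact identity = code check).
WHAT HAPPENED (first filing): refuter
g41-54's reduced MD (evidence mini_md_results.md on stmt-AtomisticToContinuum-4903; 48 NVE samples ×
t = 2000, N = 8…128) finds
D_N/N = 0 ± 0.003 for every N ≥ 16 (< 1% of C(0)/N ≈ 0.38), C(t)/N at the ±0.01 noise floor by t =
100–200 with no N-dependent plateau,
and an N-independent GK integral to t = 60 (5.6–5.9) — consistent with C1 and with a finite positive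
regular conductivity; ≥ 10 full kit jobs
(j000301 … j000957, incl. the μ-scan j000412) were queued with --workitem stmt-4903 and attach there
on completion (Abel-mean tables for C2 included). Next cheapest: the Abel means
N⁻¹∫e^{−εt}C_N at ε = 0.3…0.003 from those jobs — N-convergence at fixed ε, then ε-stability (C2).

NUMBERS. Exact scalings (mechanical similarity, AokiLukkarinenSpohn2006 §2 and the card): H(aq, a²p)
= a⁴H, Φ_t∘S_a = S_a∘Φ_{at}, Gibbs_T =
(S_{T^{1/4}})_* Gibbs_1, J∘S_a = a⁵J, C_{N,T}(t) = T^{5/2}C_{N,1}(T^{1/4}t), k(μ,T) = T^{9/4}k(μ,1),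
κ₀(T) = κ₀(1)T^{1/4}; Jacobian of
S_a = a^{3N} (U_a f = a^{3N/2}f∘S_a unitary). De Roeck–Huveneers degrees a = b = 4 (marginal,
outside asymptotic localisation). Free
ends: D_N ≡ 0 and GK_N^{Abel} = 0 exactly for every N (RigolShastry2008 mechanism). MD (first
filing): C(0)/N ≈ 0.38, D_N/N = 0 ± 0.003
(N ≥ 16), GK integral to t = 60 ≈ 5.6–5.9 at μ = T = 1. Items at open: 15 (6 crux, 8 support, 1
assembly); shared by signature with
PorousMediumCorner: 9792, 9793, 0741, 9796, 9797, 9900; verbatim from the first filing: 4901, 4903,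
4904, 4906, 4907, 4908, 4911; restated:
AnchorRegularConductivity (4902 + hypothesis D_N/N → 0).

DEFINITION REQUESTS. None load-bearing: every signature inlines the ring Hamiltonian / current
(first filing: all elaborate, no junk, N = 0, 1, 2 harmless).
Nice-to-have, shared with PorousMediumCorner and restatable 1:1 once they land: `quarticChain μ γ`,
`ringHamiltonian` / `ringCurrent`,
`currentAutocorrelation`. No cite facts wanted: Bochner is proved in tree; the dilation-class lemma
is to be PROVED (child DilationClassLemma).

Novelty: Searches (2026-08-15, this seat, on top of the card's, the first filing's and the novelty audit's):
`lit frontier AtomisticToContinuum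
--since 2020` (30 rows; arXiv:2604.14056 specific heat of driven chains and arXiv:2310.13338 =
CanestrariLiveraniOlla2026 the only
chain papers, none on Koopman spectral type or finite-ring Drude weights); `lit bridges
AtomisticToContinuum --cross any` (30 rows: Abel-prize / Ising / convex-integration surveys, none
relevant); `lit search --source crossref "Lebesgue spectrum self-similar
flow conjugate time change dilation"` (10 rows, none relevant beyond Maruyama 1967
doi:10.2969/jmsj/01930359), `… "homogeneous potential
Hamiltonian dilation symmetry Koopman operator Lebesgue spectrum mixing"` (10 rows, 0 relevant), `…
"Buttà Caglioti Di Ruzza Marchioro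
propagation"` (hits doi:10.1007/s10955-007-9278-0, doi:10.1007/s10955-016-1540-x for the RingLimit
child); `lit galaxy search "countable
Lebesgue spectrum" --star all` (13 rows: panama KatokHasselblatt1995, Petersen–Salama, Sarig's notes
pdf:4550797960, Lemańczyk's
cetds2000 — textbooks/notes on the horocycle argument, nothing on lattices), `… "Drude weight"
--star pdf` (8 rows, quantum condensed
matter incl. Heidrich-Meisner's group), three longer galaxy phrases (0 rows); `lit read
book:chern1970-global-analysis --pages 387-391`
(Tomter Prop. 20, p. 389: the exact P(μ) ↦ P(e^{tλ}μ) ⇒ Weyl-relation ⇒ Lebesgue-spectrum step);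
OpenAlex budget exhausted and the
local hybrid index down this session  [refs: 10.2969/jmsj/01930359, 10.1007/s10955-007-9278-0, 10.1007/s10955-016-1540-x, 10.1112/plms/pdp013, 10.1103/physrevb.77.161101:, 2604.14056, 2310.13338, doi:10.2969/jmsj/01930359, doi:10.1007/s10955-007-9278-0, doi:10.1007/s10955-016-1540-x, book:chern1970-global-analysis, doi:10.1112/plms/pdp013, doi:10.1103/physrevb.77.161101, CanestrariLiveraniOlla2026, GelfandFomin1952, KatokThouvenot2006, Fracz]

Barriers (technique_class: scaling-symmetry, koopman-spectral-type, green-kubo, anchor): - technique_class: scaling-symmetry, koopman-spectral-type, green-kubo, anchor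
- Literature.Barriers.AtomisticToContinuum.Mazur1969_inequality: faced, not evaded — D_N is exactly
Mazur/Suzuki's Cesàro limit (in-tree Mazur.tendsto_inv_mul_integral_inner), here an honest limit
supported on chiral invariant components; RingDrudeDecay IS the statement that no odd conserved
structure has extensive weight at the anchor, filed as a refutable crux instead of assumed away;
what K1 adds beyond Mazur is that the remainder is absolutely continuous.
- Literature.Barriers.AtomisticToContinuum.MazurBoundBallisticNarrow: evaded by construction — the
line is Drude-weight-AWARE: K1 splits the finite-N ring Green–Kubo functional into its atom D_N and
an L¹ regular part, the atom's per-site vanishing is the refutable crux RingDrudeDecay (FALSE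
verbatim for a member with an extensive odd charge: periodic harmonic or Toda rings give D_N ≍ N by
the in-tree Mazur/Suzuki equality), AnchorRegularConductivity speaks of the regular part only and is
conditional on C1, so no step 'applies verbatim' to a ballistic member; conjunct (b) of the entry
(finite OPEN chains have zero Drude weight, RigolShastry2008) is exactly support FreeEndInsulator
and is why the transport cruxes live on rings with N → ∞ before ε ↓ 0.
- Literature.Barriers.AtomisticToContinuum.HarmonicChainBallisticFlux: void inside the anchor family
(no quadratic part, no ballistic corner, all T conjugate); it returns only through LowTClosure'

Novelty grade: new-combination — g44-38 (rev-2 re-filing; the card's novelty audit and the first filing's refuters already graded the mechanism new-combination). PRIOR ART roles re-checked: GelfandFomin1952 / Tomter Prop. 20 (book:chern1970-global-analysis p.389) / KatokThouvenot2006 / FraczekLemanczyk2009 / Ryzhikov2018 = conjugac (refuter refuter-refute-pool-g44-38, 2026-08-15T20:01:32Z; prior: GelfandFomin1952, book:chern1970-global-analysis, KatokThouvenot2006, FraczekLemanczyk2009, Ryzhikov2018, Mazur1969, RigolShastry2008, HeidrichMeisnerHoneckerCabraBrenig2003, BernardinOlla2005)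

History (route lifecycle, newest last):
- 2026-08-25T04:41:54Z · DORMANT — reconciler: no traction for 7.4 d (last activity item-evidence-added at 2026-08-17T19:01:27Z); parked, not closed — `ledger route dormant route-AtomisticToConti (operator:999:3313306)

sub-problem: FouriersLaw · status: dormant · opened planner-plancard-AtomisticToContinuum-Fourier-254988dc-g2-0 2026-08-15T18:54:56Z · rev 2 · ledger route-AtomisticToContinuum-AffineAnchorRing
GENERATED by the gate from the ledger (D-0016/17). Provers cite these decls: `theorem foo : Summit.AtomisticToContinuum.FouriersLaw.Theses.AffineAnchorRing.<Decl> := …` in Summits/AtomisticToContinuum/FouriersLaw/Theorems/<Name>.lean.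
-/

namespace Summit.AtomisticToContinuum.FouriersLaw.Theses.AffineAnchorRing

open scoped BigOperators Topology Manifold Classical MeasureTheory ProbabilityTheory Matrix InnerProductSpace ComplexConjugate ContinuousMap
open Filter Set Function TopologicalSpace MeasureTheory

attribute [summit_statement] _root_.FouriersLaw

/-- item stmt-AtomisticToContinuum-12453 · crux · rank 3 · open · by planner
why it might fail: (B) is the transport problem at the anchor: no N-uniform control of the a.c. density g_N near ω = 0 exists for any deterministic anharmonic chain; K(ε) may blow up as ε ↓ 0 (μ → 0 is the anomalous quartic FPU chain) or vanish (sticky island hierarchies), although every σ_N is a.c.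
sources: BonettoLebowitzReyBellet2000, LepriLiviPoliti2003, BernardinOlla2005, BasileBernardinOlla2009, CanestrariLiveraniOlla2026, LanfordLebowitzLieb1977
[crux] (card (C2) AnchorDensity, Abel / thermodynamic-limit-first form, CONDITIONAL ON C1) RING (θ =
1), every μ, T > 0, with J_N = Σ_bonds −½(p_i+p_{i+1})(q_{i+1}−q_i)³ (wrap bond included), C_N(t) =
E_T[J_N(Φ_t·)J_N], D_N = lim_t C_N(t) (supplied by AnchorSpectralType) AND D_N/N → 0
(RingDrudeDecay, now a hypothesis): the REGULAR part has a DC limit — ∃ k > 0 and K with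
N⁻¹∫_0^∞e^{−εt}(C_N(t) − D_N)dt → K(ε) as N → ∞ for every ε > 0, and K(ε) → k as ε ↓ 0. The regular
mean is N⁻¹∫_{ω≠0} ε/(ε²+ω²)g_N(ω)dω, g_N the L¹ density of σ_{J_N} off 0 (K1); content = (A) N → ∞
at fixed ε (classical-hard: ring locality + infinite-volume dynamics + propagation bounds) and (B) ε
↓ 0 with 0 < k < ∞, the transport problem; κ₀(T) = k/T², k(μ,T) = T^{9/4}k(μ,1). [deps:
AnchorSpectralType, RingDrudeDecay] [difficulty: open-problem] -/
@[route_item "route-AtomisticToContinuum-AffineAnchorRing", crux]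
def AnchorRegularConductivity : Prop :=
  ∀ (μ T : ℝ), 0 < μ → 0 < T → ∀ H : (N : ℕ) → Literature.MathematicalPhysics.KineticTheory.HeatConduction.PhaseSpace N → ℝ, (∀ N : ℕ, H N = fun x : Literature.MathematicalPhysics.KineticTheory.HeatConduction.PhaseSpace N => (Literature.MathematicalPhysics.KineticTheory.HeatConduction.OscillatorChain.mk (fun q => μ * q ^ 4 / 4) (fun r => r ^ 4 / 4) 0).hamiltonian N x + ∑ i : Fin N, ∑ j : Fin N, if i.val + 1 = N ∧ j.val = 0 ∧ 2 < N then (x.1 j - x.1 i) ^ 4 / 4 else 0) → ∀ J : (N : ℕ) → Literature.MathematicalPhysics.KineticTheory.HeatConduction.PhaseSpace N → ℝ, (∀ N : ℕ, J N = fun x : Literature.MathematicalPhysics.KineticTheory.HeatConduction.PhaseSpace N => (∑ i : Fin N, (Literature.MathematicalPhysics.KineticTheory.HeatConduction.OscillatorChain.mk (fun q => μ * q ^ 4 / 4) (fun r => r ^ 4 / 4) 0).bondCurrent N i x) + ∑ i : Fin N, ∑ j : Fin N, if i.val + 1 = N ∧ j.val = 0 ∧ 2 < N then -((x.2 i + x.2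 j) / 2 * (x.1 j - x.1 i) ^ 3) else 0) → ∀ Φ : (N : ℕ) → ℝ → Literature.MathematicalPhysics.KineticTheory.HeatConduction.PhaseSpace N → Literature.MathematicalPhysics.KineticTheory.HeatConduction.PhaseSpace N, (∀ N : ℕ, Literature.MathematicalPhysics.KineticTheory.NewtonianFlow.IsFlow (fun (q : Fin N → ℝ) (i : Fin N) => -Literature.MathematicalPhysics.KineticTheory.HeatConduction.partialQ i (H N) (q, fun _ => 0)) (Φ N)) → ∀ D : ℕ → ℝ, (∀ N : ℕ, Filter.Tendsto (fun t : ℝ => ∫ x, J N (Φ N t x) * J N x ∂((MeasureTheory.volume : MeasureTheory.Measure (Literature.MathematicalPhysics.KineticTheory.HeatConduction.PhaseSpace N)).tilted (fun x => -(H N) x / T))) Filter.atTop (nhds (D N))) → Filter.Tendsto (fun N : ℕ => D N / N) Filter.atTop (nhds 0) → ∃ k : ℝ, 0 < k ∧ ∃ K : ℝ → ℝ, (∀ ε : ℝ, 0 < ε → Filter.Tendsto (fun N : ℕ => (N : ℝ)⁻¹ * ∫ t in Set.Ioi (0 : ℝ), Real.exp (-(ε * t)) * ((∫ x, J N (Φ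 N t x) * J N x ∂((MeasureTheory.volume : MeasureTheory.Measure (Literature.MathematicalPhysics.KineticTheory.HeatConduction.PhaseSpace N)).tilted (fun x => -(H N) x / T))) - D N)) Filter.atTop (nhds (K ε))) ∧ Filter.Tendsto K (nhdsWithin 0 (Set.Ioi 0)) (nhds k)

/-- item stmt-AtomisticToContinuum-12454 · crux · rank 4 · open · by planner
why it might fail: A positive-measure family of circulating (Π-asymmetric) KAM islands with non-vanishing Gibbs weight per site gives D_N ≍ N, a ballistic component; mixed phase space, no hyperbolicity, parameter-free model (no 'generic μ' escape); o(N) uniformly in N is open-problem class, not L.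
sources: Mazur1969, Suzuki1971, Zotos2002, MackayPercival1985, HeidrichMeisnerHoneckerCabraBrenig2003, RigolShastry2008
[crux] (card (C1) ChiralIslandDecay) RING, every μ, T > 0: the finite-N Drude atom per site
vanishes, D_N/N → 0 (D_N = lim_t C_N(t), supplied by AnchorSpectralType). By momentum reversal Π (ΠJ
= −J, Πℐ = ℐ) the atom D_N = ‖E_T[J_N|ℐ]‖² is carried by Π-asymmetric (circulating, chiral)
invariant components only, so the statement says: chiral regular islands have vanishing Gibbs weight
per site — the NECESSARY half of 0 < κ₀ < ∞ on closed chains: by Fubini σ_N{0} ≤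
ε∫_0^∞e^{−εt}C_N(t)dt, i.e. D_N/N ≤ ε·a_N(ε) for every full Abel mean, so any finite Abelian ring
conductivity forces it (helper lemma AtomBoundByAbelMean, rides with --supports). MD status: see
Cheapest falsifier. [deps: AnchorSpectralType] [difficulty: open-problem] -/
@[route_item "route-AtomisticToContinuum-AffineAnchorRing", crux]
def RingDrudeDecay : Prop :=
  ∀ (μ T : ℝ), 0 < μ → 0 < T → ∀ H : (N : ℕ) → Literature.MathematicalPhysics.KineticTheory.HeatConduction.PhaseSpace N → ℝ, (∀ N : ℕ, H N = fun x : Literature.MathematicalPhysics.KineticTheory.HeatConduction.PhaseSpace N => (Literature.MathematicalPhysics.KineticTheory.HeatConduction.OscillatorChain.mk (fun q => μ * q ^ 4 / 4) (fun r => r ^ 4 / 4) 0).hamiltonian N x + ∑ i : Fin N, ∑ j : Fin N, if i.val + 1 = N ∧ j.val = 0 ∧ 2 < N then (x.1 j - x.1 i) ^ 4 / 4 else 0) → ∀ J : (N : ℕ) → Literature.MathematicalPhysics.KineticTheory.HeatConduction.PhaseSpace N → ℝ, (∀ N : ℕ, J N = fun x : Literature.MathematicalPhysics.KineticTheory.HeatConduction.PhaseSpace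 N => (∑ i : Fin N, (Literature.MathematicalPhysics.KineticTheory.HeatConduction.OscillatorChain.mk (fun q => μ * q ^ 4 / 4) (fun r => r ^ 4 / 4) 0).bondCurrent N i x) + ∑ i : Fin N, ∑ j : Fin N, if i.val + 1 = N ∧ j.val = 0 ∧ 2 < N then -((x.2 i + x.2 j) / 2 * (x.1 j - x.1 i) ^ 3) else 0) → ∀ Φ : (N : ℕ) → ℝ → Literature.MathematicalPhysics.KineticTheory.HeatConduction.PhaseSpace N → Literature.MathematicalPhysics.KineticTheory.HeatConduction.PhaseSpace N, (∀ N : ℕ, Literature.MathematicalPhysics.KineticTheory.NewtonianFlow.IsFlow (fun (q : Fin N → ℝ) (i : Fin N) => -Literature.MathematicalPhysics.KineticTheory.HeatConduction.partialQ i (H N) (q, fun _ => 0)) (Φ N)) → ∀ D : ℕ → ℝ, (∀ N : ℕ, Filter.Tendsto (fun t : ℝ => ∫ x, J N (Φ N t x) * J N x ∂((MeasureTheory.volume : MeasureTheory.Measure (Literature.MathematicalPhysics.KineticTheory.HeatConduction.PhaseSpace N)).tilted (fun x => -(H N) x / T))) Filter.atTop (nhds (D N))) → Filter.Tendsto (fun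 N : ℕ => D N / N) Filter.atTop (nhds 0)

/-- item stmt-AtomisticToContinuum-12455 · crux · rank 5 · open · by planner
why it might fail: κ_BLR = κ_GK is unproved for every Hamiltonian bulk (BLR §7, Dhar §9e); the statement silently makes the limit independent of the bath coupling γ (the one non-scale-free datum, γ_eff = γT^{-1/4}): contact layers must be o(N) uniformly, and the open-chain gap closes like γ/N.
sources: BonettoLebowitzReyBellet2000, Dhar2008, KunduDharNarayan2009, ReyBellet2003, HairerMajda2009, CuneoEckmannHairerReyBellet2018
[crux] (κ_BLR = κ_GK at the anchor, ring form; sibling of PorousMediumCorner's infinite-volume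
AnchorThermodynamicLimit stmt-9791) For the OPEN anchor chain ⟨μq⁴/4, r⁴/4, γ⟩ between Langevin
baths and T > 0: if for the ring flow family the full Green–Kubo Abel means converge,
N⁻¹∫_0^∞e^{−εt}C_N(t)dt → K(ε) (N → ∞) and K(ε) → k (ε ↓ 0), then, under pairwise weak-NESS
uniqueness, for every steady-state family and every sequence D_N of BLR response coefficients
(D_N(T) = lim_{δ→0} totalCurrent(ν_{N,T+δ/2,T−δ/2})/δ; existence = AnchorFiniteResponse) one has D_N
→ k/T² (finite-volume Kubo formula at 0⁺ + N-uniform low-frequency control + o(N) contact layers; by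
ring locality the ring Abel means equal the infinite-volume ones at fixed ε). [deps:
AnchorRegularConductivity, RingDrudeDecay] [difficulty: open-problem] -/
@[route_item "route-AtomisticToContinuum-AffineAnchorRing", crux]
def AnchorKuboFourier : Prop :=
  ∀ (μ γ T k : ℝ), 0 < μ → 0 < γ → 0 < T → ∀ H : (N : ℕ) → Literature.MathematicalPhysics.KineticTheory.HeatConduction.PhaseSpace N → ℝ, (∀ N : ℕ, H N = fun x : Literature.MathematicalPhysics.KineticTheory.HeatConduction.PhaseSpace N => (Literature.MathematicalPhysics.KineticTheory.HeatConduction.OscillatorChain.mk (fun q => μ * q ^ 4 / 4) (fun r => r ^ 4 / 4) 0).hamiltonian N x + ∑ i : Fin N, ∑ j : Fin N, if i.val + 1 = N ∧ j.val = 0 ∧ 2 < N then (x.1 j - x.1 i) ^ 4 / 4 else 0) → ∀ J : (N : ℕ) → Literature.MathematicalPhysics.KineticTheory.HeatConduction.PhaseSpace N → ℝ, (∀ N : ℕ, J N = fun x : Literature.MathematicalPhysics.KineticTheory.HeatConduction.PhaseSpace N => (∑ i : Fin N, (Literature.MathematicalPhysics.KineticTheory.HeatConduction.OscillatorChain.mk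 (fun q => μ * q ^ 4 / 4) (fun r => r ^ 4 / 4) 0).bondCurrent N i x) + ∑ i : Fin N, ∑ j : Fin N, if i.val + 1 = N ∧ j.val = 0 ∧ 2 < N then -((x.2 i + x.2 j) / 2 * (x.1 j - x.1 i) ^ 3) else 0) → ∀ Φ : (N : ℕ) → ℝ → Literature.MathematicalPhysics.KineticTheory.HeatConduction.PhaseSpace N → Literature.MathematicalPhysics.KineticTheory.HeatConduction.PhaseSpace N, (∀ N : ℕ, Literature.MathematicalPhysics.KineticTheory.NewtonianFlow.IsFlow (fun (q : Fin N → ℝ) (i : Fin N) => -Literature.MathematicalPhysics.KineticTheory.HeatConduction.partialQ i (H N) (q, fun _ => 0)) (Φ N)) → (∃ K : ℝ → ℝ, (∀ ε : ℝ, 0 < ε → Filter.Tendsto (fun N : ℕ => (N : ℝ)⁻¹ * ∫ t in Set.Ioi (0 : ℝ), Real.exp (-(ε * t)) * ∫ x, J N (Φ N t x) * J N x ∂((MeasureTheory.volume : MeasureTheory.Measure (Literature.MathematicalPhysics.KineticTheory.HeatConduction.PhaseSpace N)).tilted (fun x => -(H N) x / T))) Filter.atTop (nhds (K ε))) ∧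 Filter.Tendsto K (nhdsWithin 0 (Set.Ioi 0)) (nhds k)) → (∀ (N : ℕ) (T_L T_R : ℝ), 0 < T_L → 0 < T_R → ∀ ν ν' : MeasureTheory.Measure (Literature.MathematicalPhysics.KineticTheory.HeatConduction.PhaseSpace N), (Literature.MathematicalPhysics.KineticTheory.HeatConduction.OscillatorChain.mk (fun q => μ * q ^ 4 / 4) (fun r => r ^ 4 / 4) γ).IsSteadyState N T_L T_R ν → (Literature.MathematicalPhysics.KineticTheory.HeatConduction.OscillatorChain.mk (fun q => μ * q ^ 4 / 4) (fun r => r ^ 4 / 4) γ).IsSteadyState N T_L T_R ν' → ν = ν') → ∀ ν : (N : ℕ) → ℝ → ℝ → MeasureTheory.Measure (Literature.MathematicalPhysics.KineticTheory.HeatConduction.PhaseSpace N), (∀ (N : ℕ) (T_L T_R : ℝ), 0 < T_L → 0 < T_R → (Literature.MathematicalPhysics.KineticTheory.HeatConduction.OscillatorChain.mk (fun q => μ * q ^ 4 / 4) (fun r => r ^ 4 / 4) γ).IsSteadyState N T_L T_R (ν N T_L T_R)) → ∀ Dn : ℕ → ℝ, (∀ N : ℕ, Filter.Tendsto (fun δ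 : ℝ => (Literature.MathematicalPhysics.KineticTheory.HeatConduction.OscillatorChain.mk (fun q => μ * q ^ 4 / 4) (fun r => r ^ 4 / 4) γ).totalCurrent (ν N (T + δ / 2) (T - δ / 2)) / δ) (nhdsWithin 0 {(0 : ℝ)}ᶜ) (nhds (Dn N))) → Filter.Tendsto Dn Filter.atTop (nhds (k / T ^ 2))

/-- item stmt-AtomisticToContinuum-9792 · crux · rank 6 · open · by planner
why it might fail: 'Fourier holds' is not known to be an open condition: hypothesis qualitative (no rate in N, nothing uniform in γ'), conclusion needs N-uniform stability under the singular perturbation η(ω₂Q²+R²)/2 (well frequency 0→√(ηω₂): ballistic germs in cold spots) at friction γη^{1/2}; print is fixed-N only.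
sources: AokiLukkarinenSpohn2006, HairerMajda2009, CuneoEckmannHairerReyBellet2018, DeRoeckHuveneers2015, decl Literature.Barriers.AtomisticToContinuum.LowTemperatureWeakAnharmonicity, decl Literature.Barriers.AtomisticToContinuum.HasBoundedResponse
[crux] η-CONTINUATION = ANCHOR STABILITY — verbatim the item EtaContinuation of route
ScaleFreeQuarticAnchor (stmt-AtomisticToContinuum-3280, its ledger signature with
OscillatorChain.HasConductivity unfolded; shared by signature): for ω₂, lam, β, γ > 0, IF the anchor
at pinning ratio lam/β has a positive BLR conductivity function for every friction γ' (the
AnchorFourier instance, which this route derives from AnchorAbelGreenKubo + AnchorDilationCovariance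
+ AnchorThermodynamicLimit + AnchorNess + AnchorFiniteResponse), THEN there is T₁ such that for
every T > T₁ the conjunct's chain pinnedChain ω₂ lam β γ obeys Fourier's law pointwise at T (∃ k >
0, ∀ steady-state families, ∃ D, responses → D N and D N → k). Dictionary: pinnedChain at T ≅ H_η =
anchor(lam/β) + η(ω₂Q² + R²)/2 at temperature 1, friction γη^(1/2), η = (βT)^(−1/2); the
porous-medium reading adds that the perturbation is relevant exactly at the COLD amplitudes where
D_th ∝ e^(1/4) degenerates (Barenblatt fronts), i.e. where local equilibrium is most fragile. [deps:
AnchorThermodynamicLimit] [difficulty: open-problem] -/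
@[route_item "route-AtomisticToContinuum-AffineAnchorRing", crux]
def EtaContinuation : Prop :=
  ∀ ω₂ lam β γ : ℝ, 0 < ω₂ → 0 < lam → 0 < β → 0 < γ → (∀ γ' : ℝ, 0 < γ' → ∃ κ₀ : ℝ → ℝ, (∀ T : ℝ, 0 < T → 0 < κ₀ T) ∧ ∀ μ : (N : ℕ) → ℝ → ℝ → MeasureTheory.Measure (Literature.MathematicalPhysics.KineticTheory.HeatConduction.PhaseSpace N), (∀ (N : ℕ) (T_L T_R : ℝ), 0 < T_L → 0 < T_R → (⟨fun q => lam / β * q ^ 4 / 4, fun r => r ^ 4 / 4, γ'⟩ : Literature.MathematicalPhysics.KineticTheory.HeatConduction.OscillatorChain).IsSteadyState N T_L T_R (μ N T_L T_R)) → ∀ T : ℝ, 0 < T → ∃ D : ℕ → ℝ, (∀ N : ℕ, Filter.Tendsto (fun δ : ℝ => (⟨fun q => lam / β * q ^ 4 / 4, fun r => r ^ 4 / 4, γ'⟩ : Literature.MathematicalPhysics.KineticTheory.HeatConduction.OscillatorChain).totalCurrent (μ N (T + δ / 2) (T - δ / 2)) / δ) (nhdsWithin 0 {(0 : ℝ)}ᶜ)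 (nhds (D N))) ∧ Filter.Tendsto D Filter.atTop (nhds (κ₀ T))) → ∃ T₁ : ℝ, ∀ T : ℝ, T₁ < T → ∃ k : ℝ, 0 < k ∧ ∀ μ : (N : ℕ) → ℝ → ℝ → MeasureTheory.Measure (Literature.MathematicalPhysics.KineticTheory.HeatConduction.PhaseSpace N), (∀ (N : ℕ) (T_L T_R : ℝ), 0 < T_L → 0 < T_R → (Literature.MathematicalPhysics.KineticTheory.HeatConduction.pinnedChain ω₂ lam β γ).IsSteadyState N T_L T_R (μ N T_L T_R)) → ∃ D : ℕ → ℝ, (∀ N : ℕ, Filter.Tendsto (fun δ : ℝ => (Literature.MathematicalPhysics.KineticTheory.HeatConduction.pinnedChain ω₂ lam β γ).totalCurrent (μ N (T + δ / 2) (T - δ / 2)) / δ) (nhdsWithin 0 {(0 : ℝ)}ᶜ) (nhds (D N))) ∧ Filter.Tendsto D Filter.atTop (nhds k)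

/-- item stmt-AtomisticToContinuum-9793 · crux · rank 7 · open · by planner
why it might fail: The high-T hypothesis carries nothing downward (no monotonicity/analyticity of T ↦ 'Fourier at T' is known), so this IS the conjunct on (0,T₁], incl. the kinetic corner T→0 ≅ λ→0 where κ ≍ (λT)⁻² is only a 'tentative' kinetic prediction (ALS2006) and prethermal scales τ₂ ∼ λ^{-2p} appear (HL2020).
sources: AokiLukkarinenSpohn2006, HuveneersLukkarinen2020, BricmontKupiainen2007, LefevereSchenkel2006, decl Literature.Barriers.AtomisticToContinuum.LowTemperatureWeakAnharmonicity, decl Literature.Barriers.AtomisticToContinuum.AokiLukkarinenSpohn2006_kineticLowTemperature_prediction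
[crux] DOWNWARD CLOSURE IN TEMPERATURE — verbatim the item LowTClosure of route
ScaleFreeQuarticAnchor (stmt-AtomisticToContinuum-3281; shared by signature; NOT this card's
mechanism): for ω₂, lam, β, γ > 0, if pinnedChain ω₂ lam β γ obeys Fourier's law pointwise at every
T above some T₁, then it does so at every T > 0 — propagation from strong to weak anharmonic
coupling at temperature 1 under the conjugacy, ending in the kinetic corner; plug-in point for
kinetic-regime routes (KineticCorner, DrudeMourre via AbelThermodynamicLimit) or for N-uniform
regularity in T (cards complete-analyticity-vitali-propagation,
countable-temperatures-suffice-equicontinuity). [deps: EtaContinuation] [difficulty: open-problem] -/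
@[route_item "route-AtomisticToContinuum-AffineAnchorRing", crux]
def LowTClosure : Prop :=
  ∀ ω₂ lam β γ : ℝ, 0 < ω₂ → 0 < lam → 0 < β → 0 < γ → (∃ T₁ : ℝ, ∀ T : ℝ, T₁ < T → ∃ k : ℝ, 0 < k ∧ ∀ μ : (N : ℕ) → ℝ → ℝ → MeasureTheory.Measure (Literature.MathematicalPhysics.KineticTheory.HeatConduction.PhaseSpace N), (∀ (N : ℕ) (T_L T_R : ℝ), 0 < T_L → 0 < T_R → (Literature.MathematicalPhysics.KineticTheory.HeatConduction.pinnedChain ω₂ lam β γ).IsSteadyState N T_L T_R (μ N T_L T_R)) → ∃ D : ℕ → ℝ, (∀ N : ℕ, Filter.Tendsto (fun δ : ℝ => (Literature.MathematicalPhysics.KineticTheory.HeatConduction.pinnedChain ω₂ lam β γ).totalCurrent (μ N (T + δ / 2) (T - δ / 2)) / δ) (nhdsWithin 0 {(0 : ℝ)}ᶜ) (nhds (D N))) ∧ Filter.Tendsto D Filter.atTop (nhds k)) → ∀ T : ℝ, 0 < T → ∃ k : ℝ, 0 < k ∧ ∀ μ : (N : ℕ) → ℝ → ℝ → MeasureTheory.Measure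 (Literature.MathematicalPhysics.KineticTheory.HeatConduction.PhaseSpace N), (∀ (N : ℕ) (T_L T_R : ℝ), 0 < T_L → 0 < T_R → (Literature.MathematicalPhysics.KineticTheory.HeatConduction.pinnedChain ω₂ lam β γ).IsSteadyState N T_L T_R (μ N T_L T_R)) → ∃ D : ℕ → ℝ, (∀ N : ℕ, Filter.Tendsto (fun δ : ℝ => (Literature.MathematicalPhysics.KineticTheory.HeatConduction.pinnedChain ω₂ lam β γ).totalCurrent (μ N (T + δ / 2) (T - δ / 2)) / δ) (nhdsWithin 0 {(0 : ℝ)}ᶜ) (nhds (D N))) ∧ Filter.Tendsto D Filter.atTop (nhds k)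

/-- item stmt-AtomisticToContinuum-12452 · support · rank 2 · open · by planner
why it might fail: Mathematically classical (dilation-invariant null ideal ⇒ Lebesgue class off 0; Bochner in tree); the risk is formal, XL: no Stone theorem / maximal spectral type in Mathlib, and the IsFlow API (uniqueness, Liouville) is global-Lipschitz only — the cubic field needs truncation.
sources: Mautner1957, GelfandFomin1952, KatokThouvenot2006, book:chern1970-global-analysis, FraczekLemanczyk2009, Ryzhikov2018
[crux] (card item 1, weak form actually used) For every N, μ > 0, wrap strength θ ≥ 0 (θ = 0 free
ends, θ = 1 ring), T > 0, the Newtonian flow Φ of H_θ = Σp²/2 + μΣq⁴/4 + Σ_{i<N-1}(q_{i+1}−q_i)⁴/4 +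
θ(q_0−q_{N−1})⁴/4 and every f ∈ L²(Gibbs_T): there is a finite measure σ_f on ℝ with E_T[f(Φ_t·)f] =
∫cos(ωt)dσ_f(ω) for all t, σ_f restricted to ℝ∖{0} absolutely continuous (no eigenvalues off 0, no
singular continuous part), and E_T[f(Φ_t·)f] → σ_f{0} = ‖E_T[f|ℐ]‖² as t → ∞ (relative mixing).
Proof: U_a f = a^{3N/2}f∘S_a and V_t are unitary on L²(Leb) with U_aV_tU_a⁻¹ = V_{at}; the null
ideal of the Bochner measures is dilation-invariant ⇒ (Fubini over Haar of (ℝ_{>0},·)) every σ_f is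
a.c. off 0; transfer to L²(Gibbs_T) by f ↦ fρ_T^{1/2}; Riemann–Lebesgue. Verified on paper by the
refuters of the first filing (stmt-4901 notes, incl. N = 0, 1). [difficulty: XL] -/
@[route_item "route-AtomisticToContinuum-AffineAnchorRing", crux]
def AnchorSpectralType : Prop :=
  ∀ (N : ℕ) (μ θ T : ℝ), 0 < μ → 0 ≤ θ → 0 < T → ∀ H : Literature.MathematicalPhysics.KineticTheory.HeatConduction.PhaseSpace N → ℝ, H = (fun x : Literature.MathematicalPhysics.KineticTheory.HeatConduction.PhaseSpace N => (Literature.MathematicalPhysics.KineticTheory.HeatConduction.OscillatorChain.mk (fun q => μ * q ^ 4 / 4) (fun r => r ^ 4 / 4) 0).hamiltonian N x + θ * ∑ i : Fin N, ∑ j : Fin N, if i.val + 1 = N ∧ j.val = 0 ∧ 2 < N then (x.1 j - x.1 i) ^ 4 / 4 else 0) → ∀ Φ : ℝ → Literature.MathematicalPhysics.KineticTheory.HeatConduction.PhaseSpace N → Literature.MathematicalPhysics.KineticTheory.HeatConduction.PhaseSpace N, Literature.MathematicalPhysics.KineticTheory.NewtonianFlow.IsFlow (fun (q : Fin N → ℝ)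 (i : Fin N) => -Literature.MathematicalPhysics.KineticTheory.HeatConduction.partialQ i H (q, fun _ => 0)) Φ → ∀ f : Literature.MathematicalPhysics.KineticTheory.HeatConduction.PhaseSpace N → ℝ, MeasureTheory.MemLp f 2 ((MeasureTheory.volume : MeasureTheory.Measure (Literature.MathematicalPhysics.KineticTheory.HeatConduction.PhaseSpace N)).tilted (fun x => -H x / T)) → ∃ σ : MeasureTheory.Measure ℝ, MeasureTheory.IsFiniteMeasure σ ∧ (∀ t : ℝ, ∫ x, f (Φ t x) * f x ∂((MeasureTheory.volume : MeasureTheory.Measure (Literature.MathematicalPhysics.KineticTheory.HeatConduction.PhaseSpace N)).tilted (fun x => -H x / T)) = ∫ ω, Real.cos (ω * t) ∂σ) ∧ (σ.restrict {0}ᶜ).AbsolutelyContinuous MeasureTheory.volume ∧ Filter.Tendsto (fun t : ℝ => ∫ x, f (Φ t x) * f x ∂((MeasureTheory.volume : MeasureTheory.Measure (Literature.MathematicalPhysics.KineticTheory.HeatConduction.PhaseSpace N)).tilted (fun x => -H x / T))) Filter.atTop (nhds (σ {0}).toReal)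

/-- item stmt-AtomisticToContinuum-0741 · support · rank 9 · closed · proved by Summit.AtomisticToContinuum.FouriersLaw.Theorems.nessUnique_proof (prover) · by planner
sources: CuneoEckmannHairerReyBellet2018, Carmona2007
[crux] UNIQUENESS OF THE WEAK STEADY STATE (the half of stmt-0706 not covered by the landed fact
Literature.MathematicalPhysics.KineticTheory.HeatConduction.CuneoEckmannHairerReyBellet2018_pinnedChain,
p3544): for pinnedChain ω₂ lam β γ (all > 0), every N and T_L, T_R > 0, any two measures in the weak
Fokker–Planck class IsSteadyState (probability, ∫ L f dμ = 0 for f ∈ C_c^∞, bond currents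
integrable) coincide. Print: uniqueness of the INVARIANT MEASURE of the Langevin semigroup
(CuneoEckmannHairerReyBellet2018 Thm 2.13(1): C1, C2, CA; Carmona2007 Thm 1.1(iii)); the item
additionally needs 'weak stationary probability solution of L*μ = 0 ⇒ P_t-invariant' for this
hypoelliptic L with cubic drift (Echeverría 1982 well-posed martingale problem on C_c^∞ +
non-explosion via e^{θH}; Bogachev–Krylov–Röckner–Shaposhnikov 2015 Ch. 5 is non-degenerate only) —
the FP-identification lemma is the formal crux. N = 0: PhaseSpace 0 is a point (unique probability
measure); N = 1: both baths on site 0, OU at temperature (T_L+T_R)/2. This is exactly the hypothesis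
of FiniteResponse and ThermodynamicLimit and, with the fact, gives clause (i) of FouriersLawFor. -/
@[route_item "route-AtomisticToContinuum-AffineAnchorRing", crux]
def NessUnique : Prop :=
  ∀ ω₂ lam β γ : ℝ, 0 < ω₂ → 0 < lam → 0 < β → 0 < γ → ∀ (N : ℕ) (T_L T_R : ℝ), 0 < T_L → 0 < T_R → ∀ μ ν : MeasureTheory.Measure (Literature.MathematicalPhysics.KineticTheory.HeatConduction.PhaseSpace N), (Literature.MathematicalPhysics.KineticTheory.HeatConduction.pinnedChain ω₂ lam β γ).IsSteadyState N T_L T_R μ → (Literature.MathematicalPhysics.KineticTheory.HeatConduction.pinnedChain ω₂ lam β γ).IsSteadyState N T_L T_R ν → μ = ν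

/-- `NessUnique` holds: proved by `Summit.AtomisticToContinuum.FouriersLaw.Theorems.nessUnique_proof`. -/
theorem NessUnique_holds : NessUnique := _root_.Summit.AtomisticToContinuum.FouriersLaw.Theorems.nessUnique_proof

/-- item stmt-AtomisticToContinuum-12456 · support · rank 9 · open · by planner
sources: BonettoLebowitzReyBellet2000, CuneoEckmannHairerReyBellet2018
[support] For every N, μ > 0, θ ≥ 0, T > 0 the tilted measure volume.tilted(−H_θ/T) is a probability
measure (e^{−H_θ/T} integrable: H_θ ≥ Σp²/2 + μΣq⁴/4) and the θ-ring current is in L²(Gibbs)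
(polynomial × Gaussian-in-p × e^{−quartic}). Used by `closes` at θ = 1. Verbatim stmt-4906.
[difficulty: provable-now] -/
@[route_item "route-AtomisticToContinuum-AffineAnchorRing", crux]
def AnchorCurrentMemLp : Prop :=
  ∀ (N : ℕ) (μ θ T : ℝ), 0 < μ → 0 ≤ θ → 0 < T → ∀ H : Literature.MathematicalPhysics.KineticTheory.HeatConduction.PhaseSpace N → ℝ, H = (fun x : Literature.MathematicalPhysics.KineticTheory.HeatConduction.PhaseSpace N => (Literature.MathematicalPhysics.KineticTheory.HeatConduction.OscillatorChain.mk (fun q => μ * q ^ 4 / 4) (fun r => r ^ 4 / 4) 0).hamiltonian N x + θ * ∑ i : Fin N, ∑ j : Fin N, if i.val + 1 = N ∧ j.val = 0 ∧ 2 < N then (x.1 j - x.1 i) ^ 4 / 4 else 0) → ∀ J : Literature.MathematicalPhysics.KineticTheory.HeatConduction.PhaseSpace N → ℝ, J = (fun x : Literature.MathematicalPhysics.KineticTheory.HeatConduction.PhaseSpace N => (∑ i : Fin N, (Literature.MathematicalPhysics.KineticTheory.HeatConduction.OscillatorChain.mk (fun q => μ * q ^ 4 / 4) (fun r => r ^ 4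 / 4) 0).bondCurrent N i x) + ∑ i : Fin N, ∑ j : Fin N, if i.val + 1 = N ∧ j.val = 0 ∧ 2 < N then -((x.2 i + x.2 j) / 2 * (θ * (x.1 j - x.1 i) ^ 3)) else 0) → MeasureTheory.IsProbabilityMeasure ((MeasureTheory.volume : MeasureTheory.Measure (Literature.MathematicalPhysics.KineticTheory.HeatConduction.PhaseSpace N)).tilted (fun x => -H x / T)) ∧ MeasureTheory.MemLp J 2 ((MeasureTheory.volume : MeasureTheory.Measure (Literature.MathematicalPhysics.KineticTheory.HeatConduction.PhaseSpace N)).tilted (fun x => -H x / T))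

/-- item stmt-AtomisticToContinuum-12457 · support · rank 9 · open · by planner
sources: LanfordLebowitzLieb1977, BonettoLebowitzReyBellet2000, decl Literature.MathematicalPhysics.KineticTheory.NewtonianFlow.IsFlow
[support] For every N, μ > 0, θ ≥ 0 the Newtonian flow of H_θ exists globally (energy conservation +
coercivity; local Lipschitz uniqueness), conserves H_θ, and preserves Lebesgue measure (Liouville:
truncate the cubic field on a sublevel set, NewtonianFlow.IsSolutionFamily.measurePreserving).
De-vacuifies the ∀Φ-items. Verbatim stmt-4907. [difficulty: provable-now] -/
@[route_item "route-AtomisticToContinuum-AffineAnchorRing", crux]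
def AnchorFlow : Prop :=
  ∀ (N : ℕ) (μ θ : ℝ), 0 < μ → 0 ≤ θ → ∀ H : Literature.MathematicalPhysics.KineticTheory.HeatConduction.PhaseSpace N → ℝ, H = (fun x : Literature.MathematicalPhysics.KineticTheory.HeatConduction.PhaseSpace N => (Literature.MathematicalPhysics.KineticTheory.HeatConduction.OscillatorChain.mk (fun q => μ * q ^ 4 / 4) (fun r => r ^ 4 / 4) 0).hamiltonian N x + θ * ∑ i : Fin N, ∑ j : Fin N, if i.val + 1 = N ∧ j.val = 0 ∧ 2 < N then (x.1 j - x.1 i) ^ 4 / 4 else 0) → ∃ Φ : ℝ → Literature.MathematicalPhysics.KineticTheory.HeatConduction.PhaseSpace N → Literature.MathematicalPhysics.KineticTheory.HeatConduction.PhaseSpace N, Literature.MathematicalPhysics.KineticTheory.NewtonianFlow.IsFlow (fun (q : Fin N → ℝ) (i : Fin N) => -Literature.MathematicalPhysics.KineticTheory.HeatConduction.partialQ i H (q, fun _ => 0)) Φ ∧ (∀ (t : ℝ) (x : Literature.MathematicalPhysics.KineticTheory.HeatConduction.PhaseSpace N), H (Φ t x) = H x) ∧ ∀ t : ℝ, MeasureTheory.MeasurePreserving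 (Φ t) MeasureTheory.volume MeasureTheory.volume

/-- item stmt-AtomisticToContinuum-12458 · support · rank 9 · open · by planner
sources: BenentiCasatiMejiaMonasterioPeyrard2016, folklore
[support] Pure real analysis (verbatim stmt-4908, which carries 13 sorry-free candidate proofs as
evidence — land one): for continuous c_N with |c_N(t)| ≤ c_N(0), c_N(t) → D_N, D_N/N → 0 and
N⁻¹∫_0^∞e^{−εt}(c_N − D_N) → K(ε) for every ε > 0, also N⁻¹∫_0^∞e^{−εt}c_N → K(ε) (the atom
contributes D_N/(Nε) → 0). Used by `closes` between C1 ∧ C2 and K3. [difficulty: provable-now] -/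
@[route_item "route-AtomisticToContinuum-AffineAnchorRing", crux]
def DrudeRegularGlue : Prop :=
  ∀ (C : ℕ → ℝ → ℝ) (D : ℕ → ℝ) (K : ℝ → ℝ), (∀ N : ℕ, Continuous (C N)) → (∀ (N : ℕ) (t : ℝ), |C N t| ≤ C N 0) → (∀ N : ℕ, Filter.Tendsto (C N) Filter.atTop (nhds (D N))) → Filter.Tendsto (fun N : ℕ => D N / N) Filter.atTop (nhds 0) → (∀ ε : ℝ, 0 < ε → Filter.Tendsto (fun N : ℕ => (N : ℝ)⁻¹ * ∫ t in Set.Ioi (0 : ℝ), Real.exp (-(ε * t)) * (C N t - D N)) Filter.atTop (nhds (K ε))) → ∀ ε : ℝ, 0 < ε → Filter.Tendsto (fun N : ℕ => (N : ℝ)⁻¹ * ∫ t in Set.Ioi (0 : ℝ), Real.exp (-(ε * t)) * C N t) Filter.atTop (nhds (K ε))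

/-- item stmt-AtomisticToContinuum-12459 · support · rank 9 · open · by planner
sources: RigolShastry2008, Mazur1969, decl Literature.Barriers.AtomisticToContinuum.MazurBoundBallisticNarrow
[support] (card corollary (3), calibration; NOT in `closes`) FREE ENDS (θ = 0), every N, μ, T > 0:
J_N = 𝓛G_N with the energy dipole G_N = Σ_x x·h_x, so J_N ⊥ ker 𝓛: C_N(t) → 0 as t → ∞ AND the
Abel-regularised finite-N Green–Kubo integral ∫_0^∞e^{−εt}C_N(t)dt → 0 as ε ↓ 0 — finite free-end
chains are exact insulators at ω = 0 (σ_J = ω²σ_G): closed-chain certificates must live on rings.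
Verbatim stmt-4911 (theorem-grade given K1). [difficulty: M] -/
@[route_item "route-AtomisticToContinuum-AffineAnchorRing"]
def FreeEndInsulator : Prop :=
  ∀ (N : ℕ) (μ T : ℝ), 0 < μ → 0 < T → ∀ H : Literature.MathematicalPhysics.KineticTheory.HeatConduction.PhaseSpace N → ℝ, H = (fun x : Literature.MathematicalPhysics.KineticTheory.HeatConduction.PhaseSpace N => (Literature.MathematicalPhysics.KineticTheory.HeatConduction.OscillatorChain.mk (fun q => μ * q ^ 4 / 4) (fun r => r ^ 4 / 4) 0).hamiltonian N x) → ∀ J : Literature.MathematicalPhysics.KineticTheory.HeatConduction.PhaseSpace N → ℝ, J = (fun x : Literature.MathematicalPhysics.KineticTheory.HeatConduction.PhaseSpace N => ∑ i : Fin N, (Literature.MathematicalPhysics.KineticTheory.HeatConduction.OscillatorChain.mk (fun q => μ * q ^ 4 / 4) (fun r => r ^ 4 / 4) 0).bondCurrent N i x) → ∀ Φ : ℝ → Literature.MathematicalPhysics.KineticTheory.HeatConduction.PhaseSpace N → Literature.MathematicalPhysics.KineticTheory.HeatConduction.PhaseSpace N, Literature.MathematicalPhysics.KineticTheory.NewtonianFlow.IsFlow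 (fun (q : Fin N → ℝ) (i : Fin N) => -Literature.MathematicalPhysics.KineticTheory.HeatConduction.partialQ i H (q, fun _ => 0)) Φ → Filter.Tendsto (fun t : ℝ => ∫ x, J (Φ t x) * J x ∂((MeasureTheory.volume : MeasureTheory.Measure (Literature.MathematicalPhysics.KineticTheory.HeatConduction.PhaseSpace N)).tilted (fun x => -H x / T))) Filter.atTop (nhds 0) ∧ Filter.Tendsto (fun ε : ℝ => ∫ t in Set.Ioi (0 : ℝ), Real.exp (-(ε * t)) * ∫ x, J (Φ t x) * J x ∂((MeasureTheory.volume : MeasureTheory.Measure (Literature.MathematicalPhysics.KineticTheory.HeatConduction.PhaseSpace N)).tilted (fun x => -H x / T))) (nhdsWithin 0 (Set.Ioi 0)) (nhds 0)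

/-- item stmt-AtomisticToContinuum-9796 · support · rank 9 · open · by planner
sources: CuneoEckmannHairerReyBellet2018, Carmona2007, EckmannPilletReyBellet1999b, ReyBelletThomas2002
[support] NESS EXISTENCE AND UNIQUENESS FOR THE BATH-DRIVEN ANCHOR — verbatim the item AnchorNess of
route AffineAnchor (stmt-AtomisticToContinuum-4910; shared by signature): for μ, γ > 0, every N and
T_L, T_R > 0 the chain ⟨μq⁴/4, r⁴/4, γ⟩ has a weak steady state and any other coincides with it
(CEHR 2018 Thm 2.13: C2 by Example 2.5 although V″(0) = 0, C5 with ℓ_i = ℓ_p = 4; the tree proof for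
pinnedChain must be adapted — cf. ScaleFreeQuarticAnchor's AnchorSteadyStateExists stmt-3286 for the
existence half). Supplies the uniqueness hypothesis of AnchorThermodynamicLimit and
AnchorFiniteResponse. [difficulty: L] -/
@[route_item "route-AtomisticToContinuum-AffineAnchorRing", crux]
def AnchorNess : Prop :=
  ∀ μ γ : ℝ, 0 < μ → 0 < γ → ∀ (N : ℕ) (T_L T_R : ℝ), 0 < T_L → 0 < T_R → ∃ ν : MeasureTheory.Measure (Literature.MathematicalPhysics.KineticTheory.HeatConduction.PhaseSpace N), (Literature.MathematicalPhysics.KineticTheory.HeatConduction.OscillatorChain.mk (fun q => μ * q ^ 4 / 4) (fun r => r ^ 4 / 4) γ).IsSteadyState N T_L T_R ν ∧ ∀ ν' : MeasureTheory.Measure (Literature.MathematicalPhysics.KineticTheory.HeatConduction.PhaseSpace N), (Literature.MathematicalPhysics.KineticTheory.HeatConduction.OscillatorChain.mk (fun q => μ * q ^ 4 / 4) (fun r => r ^ 4 / 4) γ).IsSteadyState N T_L T_R ν' → ν' = ν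

/-- item stmt-AtomisticToContinuum-9797 · support · rank 9 · open · by planner
sources: ReyBellet2003, HairerMajda2009, CuneoEckmannHairerReyBellet2018, Carmona2007
[support] FINITE-N LINEAR RESPONSE OF THE BATH-DRIVEN ANCHOR UNDER UNIQUENESS — verbatim the item
AnchorFiniteResponse of route AffineAnchor (stmt-AtomisticToContinuum-4909; shared by signature):
for μ, γ > 0, under pairwise weak-NESS uniqueness, for every steady-state family, every T > 0 and N
the response limit D_N(T) = lim_(δ→0, δ≠0) totalCurrent(ν N (T+δ/2) (T−δ/2))/δ exists (anchor copy
of FiniteResponseOfUnique stmt-0717). [difficulty: L] -/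
@[route_item "route-AtomisticToContinuum-AffineAnchorRing", crux]
def AnchorFiniteResponse : Prop :=
  ∀ μ γ : ℝ, 0 < μ → 0 < γ → (∀ (N : ℕ) (T_L T_R : ℝ), 0 < T_L → 0 < T_R → ∀ ν ν' : MeasureTheory.Measure (Literature.MathematicalPhysics.KineticTheory.HeatConduction.PhaseSpace N), (Literature.MathematicalPhysics.KineticTheory.HeatConduction.OscillatorChain.mk (fun q => μ * q ^ 4 / 4) (fun r => r ^ 4 / 4) γ).IsSteadyState N T_L T_R ν → (Literature.MathematicalPhysics.KineticTheory.HeatConduction.OscillatorChain.mk (fun q => μ * q ^ 4 / 4) (fun r => r ^ 4 / 4) γ).IsSteadyState N T_L T_R ν' → ν = ν') → ∀ ν : (N : ℕ) → ℝ → ℝ → MeasureTheory.Measure (Literature.MathematicalPhysics.KineticTheory.HeatConduction.PhaseSpace N), (∀ (N : ℕ) (T_L T_R : ℝ), 0 < T_L → 0 < T_R → (Literature.MathematicalPhysics.KineticTheory.HeatConduction.OscillatorChain.mk (fun q => μ * q ^ 4 / 4) (fun r => r ^ 4 / 4) γ).IsSteadyState N T_L T_R (ν N T_L T_R)) → ∀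 T : ℝ, 0 < T → ∀ N : ℕ, ∃ D : ℝ, Filter.Tendsto (fun δ : ℝ => (Literature.MathematicalPhysics.KineticTheory.HeatConduction.OscillatorChain.mk (fun q => μ * q ^ 4 / 4) (fun r => r ^ 4 / 4) γ).totalCurrent (ν N (T + δ / 2) (T - δ / 2)) / δ) (nhdsWithin 0 {(0 : ℝ)}ᶜ) (nhds D)

/-- item stmt-AtomisticToContinuum-9900 · support · rank 9 · closed · proved by Summit.AtomisticToContinuum.FouriersLaw.Theorems.pinnedSteadyStateExists_proof @ 93199528ccef (prover) · by planner
sources: CuneoEckmannHairerReyBellet2018, Carmona2007, decl Literature.MathematicalPhysics.KineticTheory.HeatConduction.pinnedChain_exists_isSteadyState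
[support] CLAUSE (i) EXISTENCE FOR THE CONJUNCT'S CHAIN (route-repair 2026-08-15, cone bookkeeping;
provable now; kind support, rank 9): for pinnedChain ω₂ lam β γ with ω₂, lam, β, γ > 0, every N and
all T_L, T_R > 0 there is a weak (Fokker–Planck) steady state (OscillatorChain.IsSteadyState).
PROVED in tree:
Literature.MathematicalPhysics.KineticTheory.HeatConduction.pinnedChain_exists_isSteadyState
(LangevinChainNESSHolds.lean; the discharged fact CuneoEckmannHairerReyBellet2018_pinnedChain for N
≥ 1 + OscillatorChain.isSteadyState_zero for N = 0) — a Theorems file importing the route file +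
LangevinChainNESSHolds closes it in one line (evidence file attached:
PinnedSteadyStateExistsProof.lean, rc 0, axioms propext/Classical.choice/Quot.sound). WHY AN ITEM:
it lets the deciding theorem 'closes' take clause (i) existence as a hypothesis, so that the Theses
file can drop the import Literature.MathematicalPhysics.KineticTheory.LangevinChainNESSHolds
(≈55-module Langevin-SDE cone with the two undischarged Kolmogorov–Chentsov Hölder facts) — the
pending route-repair edit (imports := [InfiniteChainDynamics], closes re-proved, Assembly restated;
package attached as evidence to the route -/
@[route_item "route-AtomisticToContinuum-AffineAnchorRing", crux]
def PinnedSteadyStateExists : Prop :=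
  ∀ ω₂ lam β γ : ℝ, 0 < ω₂ → 0 < lam → 0 < β → 0 < γ → ∀ (N : ℕ) (T_L T_R : ℝ), 0 < T_L → 0 < T_R → ∃ μ : MeasureTheory.Measure (Literature.MathematicalPhysics.KineticTheory.HeatConduction.PhaseSpace N), (Literature.MathematicalPhysics.KineticTheory.HeatConduction.pinnedChain ω₂ lam β γ).IsSteadyState N T_L T_R μ

/-- `PinnedSteadyStateExists` holds: proved by `Summit.AtomisticToContinuum.FouriersLaw.Theorems.pinnedSteadyStateExists_proof` @ 93199528ccef. -/
theorem PinnedSteadyStateExists_holds : PinnedSteadyStateExists := _root_.Summit.AtomisticToContinuum.FouriersLaw.Theorems.pinnedSteadyStateExists_proof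

/-- item stmt-AtomisticToContinuum-12460 · assembly · rank 1 · open · by planner
sources: BonettoLebowitzReyBellet2000, AokiLukkarinenSpohn2006
[assembly] AnchorSpectralType → AnchorCurrentMemLp → AnchorFlow → RingDrudeDecay →
AnchorRegularConductivity → DrudeRegularGlue → AnchorFiniteResponse → AnchorKuboFourier → AnchorNess
→ EtaContinuation → LowTClosure → NessUnique → PinnedSteadyStateExists → FouriersLaw (the
sub-problem Statement decl `FouriersLaw` by name; = the type of `closes`). -/
@[route_item "route-AtomisticToContinuum-AffineAnchorRing"]
def Assembly : Prop :=
  AnchorSpectralType → AnchorCurrentMemLp → AnchorFlow → RingDrudeDecay → AnchorRegularConductivity → DrudeRegularGlue → AnchorFiniteResponse → AnchorKuboFourier → AnchorNess → EtaContinuation → LowTClosure → NessUnique → PinnedSteadyStateExists → FouriersLaw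

/-! D-0027 §2.1 — DECIDING THEOREM (planner-authored via `route open/edit --closes-file`; by planner-plancard-AtomisticToContinuum-Fourier-254988dc-g2-0 2026-08-15T18:54:56Z):
its hypotheses are this route's items and its conclusion the sub-problem Statement (glue_lint), and it elaborates with this file. -/

@[closes "route-AtomisticToContinuum-AffineAnchorRing"] theorem closes : AnchorSpectralType → AnchorCurrentMemLp → AnchorFlow → RingDrudeDecay →
    AnchorRegularConductivity → DrudeRegularGlue → AnchorFiniteResponse → AnchorKuboFourier →
    AnchorNess → EtaContinuation → LowTClosure → NessUnique → PinnedSteadyStateExists →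
    FouriersLaw := by
  intro hK1 hMem hFlow hC1 hC2 hGlue hFR hK3 hNess hEta hLow hU hEx
  have hAF : ∀ μ γ : ℝ, 0 < μ → 0 < γ → ∃ κ : ℝ → ℝ, (∀ T : ℝ, 0 < T → 0 < κ T) ∧
      ∀ ν : (N : ℕ) → ℝ → ℝ → MeasureTheory.Measure (Literature.MathematicalPhysics.KineticTheory.HeatConduction.PhaseSpace N),
        (∀ (N : ℕ) (T_L T_R : ℝ), 0 < T_L → 0 < T_R →
          (⟨fun q => μ * q ^ 4 / 4, fun r => r ^ 4 / 4, γ⟩ :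
            Literature.MathematicalPhysics.KineticTheory.HeatConduction.OscillatorChain).IsSteadyState N T_L T_R (ν N T_L T_R)) →
        ∀ T : ℝ, 0 < T → ∃ D : ℕ → ℝ,
          (∀ N : ℕ, Filter.Tendsto (fun δ : ℝ =>
            (⟨fun q => μ * q ^ 4 / 4, fun r => r ^ 4 / 4, γ⟩ :
              Literature.MathematicalPhysics.KineticTheory.HeatConduction.OscillatorChain).totalCurrent (ν N (T + δ / 2) (T - δ / 2)) / δ)
            (nhdsWithin 0 {(0 : ℝ)}ᶜ) (nhds (D N))) ∧ Filter.Tendsto D Filter.atTop (nhds (κ T)) := by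
    intro μ γ hμ hγ
    have huniq : ∀ (N : ℕ) (T_L T_R : ℝ), 0 < T_L → 0 < T_R →
        ∀ ν ν' : MeasureTheory.Measure (Literature.MathematicalPhysics.KineticTheory.HeatConduction.PhaseSpace N),
          (Literature.MathematicalPhysics.KineticTheory.HeatConduction.OscillatorChain.mk (fun q => μ * q ^ 4 / 4) (fun r => r ^ 4 / 4) γ).IsSteadyState N T_L T_R ν →
          (Literature.MathematicalPhysics.KineticTheory.HeatConduction.OscillatorChain.mk (fun q => μ * q ^ 4 / 4) (fun r => r ^ 4 / 4) γ).IsSteadyState N T_L T_R ν' → ν = ν' := by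
      intro N T_L T_R hL hR ν ν' hν hν'
      obtain ⟨ρ, _, hρ⟩ := hNess μ γ hμ hγ N T_L T_R hL hR
      exact (hρ ν hν).trans (hρ ν' hν').symm
    obtain ⟨H, hH⟩ : ∃ H : (N : ℕ) → Literature.MathematicalPhysics.KineticTheory.HeatConduction.PhaseSpace N → ℝ,
        ∀ N : ℕ, H N = fun x : Literature.MathematicalPhysics.KineticTheory.HeatConduction.PhaseSpace N =>
          (Literature.MathematicalPhysics.KineticTheory.HeatConduction.OscillatorChain.mk (fun q => μ * q ^ 4 / 4) (fun r => r ^ 4 / 4) 0).hamiltonian N x +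
            ∑ i : Fin N, ∑ j : Fin N, if i.val + 1 = N ∧ j.val = 0 ∧ 2 < N then (x.1 j - x.1 i) ^ 4 / 4 else 0 :=
      ⟨_, fun N => rfl⟩
    obtain ⟨J, hJ⟩ : ∃ J : (N : ℕ) → Literature.MathematicalPhysics.KineticTheory.HeatConduction.PhaseSpace N → ℝ,
        ∀ N : ℕ, J N = fun x : Literature.MathematicalPhysics.KineticTheory.HeatConduction.PhaseSpace N =>
          (∑ i : Fin N, (Literature.MathematicalPhysics.KineticTheory.HeatConduction.OscillatorChain.mk (fun q => μ * q ^ 4 / 4) (fun r => r ^ 4 / 4) 0).bondCurrent N i x) +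
            ∑ i : Fin N, ∑ j : Fin N, if i.val + 1 = N ∧ j.val = 0 ∧ 2 < N then -((x.2 i + x.2 j) / 2 * (x.1 j - x.1 i) ^ 3) else 0 :=
      ⟨_, fun N => rfl⟩
    have hH1 : ∀ N : ℕ, H N = fun x : Literature.MathematicalPhysics.KineticTheory.HeatConduction.PhaseSpace N =>
        (Literature.MathematicalPhysics.KineticTheory.HeatConduction.OscillatorChain.mk (fun q => μ * q ^ 4 / 4) (fun r => r ^ 4 / 4) 0).hamiltonian N x +
          1 * ∑ i : Fin N, ∑ j : Fin N, if i.val + 1 = N ∧ j.val = 0 ∧ 2 < N then (x.1 j - x.1 i) ^ 4 / 4 else 0 := by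
      intro N; rw [hH N]; simp only [one_mul]
    have hJ1 : ∀ N : ℕ, J N = fun x : Literature.MathematicalPhysics.KineticTheory.HeatConduction.PhaseSpace N =>
        (∑ i : Fin N, (Literature.MathematicalPhysics.KineticTheory.HeatConduction.OscillatorChain.mk (fun q => μ * q ^ 4 / 4) (fun r => r ^ 4 / 4) 0).bondCurrent N i x) +
          ∑ i : Fin N, ∑ j : Fin N, if i.val + 1 = N ∧ j.val = 0 ∧ 2 < N then -((x.2 i + x.2 j) / 2 * (1 * (x.1 j - x.1 i) ^ 3)) else 0 := by
      intro N; rw [hJ N]; simp only [one_mul]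
    have hfl : ∀ N : ℕ, ∃ Φ : ℝ → Literature.MathematicalPhysics.KineticTheory.HeatConduction.PhaseSpace N → Literature.MathematicalPhysics.KineticTheory.HeatConduction.PhaseSpace N,
        Literature.MathematicalPhysics.KineticTheory.NewtonianFlow.IsFlow (fun (q : Fin N → ℝ) (i : Fin N) => -Literature.MathematicalPhysics.KineticTheory.HeatConduction.partialQ i (H N) (q, fun _ => 0)) Φ ∧
          (∀ (t : ℝ) (x : Literature.MathematicalPhysics.KineticTheory.HeatConduction.PhaseSpace N), H N (Φ t x) = H N x) ∧
            ∀ t : ℝ, MeasureTheory.MeasurePreserving (Φ t) MeasureTheory.volume MeasureTheory.volume :=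
      fun N => hFlow N μ 1 hμ zero_le_one (H N) (hH1 N)
    choose Φ hΦ using hfl
    have hw : ∀ T : ℝ, 0 < T → ∃ κT : ℝ, 0 < κT ∧
        ∀ ν : (N : ℕ) → ℝ → ℝ → MeasureTheory.Measure (Literature.MathematicalPhysics.KineticTheory.HeatConduction.PhaseSpace N),
          (∀ (N : ℕ) (T_L T_R : ℝ), 0 < T_L → 0 < T_R →
            (Literature.MathematicalPhysics.KineticTheory.HeatConduction.OscillatorChain.mk (fun q => μ * q ^ 4 / 4) (fun r => r ^ 4 / 4) γ).IsSteadyState N T_L T_R (ν N T_L T_R)) →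
          ∀ Dn : ℕ → ℝ, (∀ N : ℕ, Filter.Tendsto (fun δ : ℝ =>
            (Literature.MathematicalPhysics.KineticTheory.HeatConduction.OscillatorChain.mk (fun q => μ * q ^ 4 / 4) (fun r => r ^ 4 / 4) γ).totalCurrent (ν N (T + δ / 2) (T - δ / 2)) / δ)
              (nhdsWithin 0 {(0 : ℝ)}ᶜ) (nhds (Dn N))) → Filter.Tendsto Dn Filter.atTop (nhds κT) := by
      intro T hT
      have hsp : ∀ N : ℕ, ∃ σ : MeasureTheory.Measure ℝ, MeasureTheory.IsFiniteMeasure σ ∧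
          (∀ t : ℝ, ∫ x, J N (Φ N t x) * J N x ∂((MeasureTheory.volume : MeasureTheory.Measure (Literature.MathematicalPhysics.KineticTheory.HeatConduction.PhaseSpace N)).tilted (fun x => -(H N) x / T)) = ∫ ω, Real.cos (ω * t) ∂σ) ∧
          (σ.restrict {0}ᶜ).AbsolutelyContinuous MeasureTheory.volume ∧
          Filter.Tendsto (fun t : ℝ => ∫ x, J N (Φ N t x) * J N x ∂((MeasureTheory.volume : MeasureTheory.Measure (Literature.MathematicalPhysics.KineticTheory.HeatConduction.PhaseSpace N)).tilted (fun x => -(H N) x / T))) Filter.atTop (nhds (σ {0}).toReal) :=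
        fun N => hK1 N μ 1 T hμ zero_le_one hT (H N) (hH1 N) (Φ N) (hΦ N).1 (J N)
          (hMem N μ 1 T hμ zero_le_one hT (H N) (hH1 N) (J N) (hJ1 N)).2
      choose σ hσ using hsp
      obtain ⟨D, hDdef⟩ : ∃ D : ℕ → ℝ, ∀ N : ℕ, D N = (σ N {0}).toReal := ⟨_, fun N => rfl⟩
      have hD : ∀ N : ℕ, Filter.Tendsto (fun t : ℝ => ∫ x, J N (Φ N t x) * J N x ∂((MeasureTheory.volume : MeasureTheory.Measure (Literature.MathematicalPhysics.KineticTheory.HeatConduction.PhaseSpace N)).tilted (fun x => -(H N) x / T))) Filter.atTop (nhds (D N)) := by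
        intro N; rw [hDdef N]; exact (hσ N).2.2.2
      have hdrude := hC1 μ T hμ hT H hH J hJ Φ (fun N => (hΦ N).1) D hD
      obtain ⟨k, hk, K, hreg, hK⟩ := hC2 μ T hμ hT H hH J hJ Φ (fun N => (hΦ N).1) D hD hdrude
      have hcont : ∀ N : ℕ, Continuous (fun t : ℝ => ∫ x, J N (Φ N t x) * J N x ∂((MeasureTheory.volume : MeasureTheory.Measure (Literature.MathematicalPhysics.KineticTheory.HeatConduction.PhaseSpace N)).tilted (fun x => -(H N) x / T))) := by
        intro N
        have heq : (fun t : ℝ => ∫ x, J N (Φ N t x) * J N x ∂((MeasureTheory.volume : MeasureTheory.Measure (Literature.MathematicalPhysics.KineticTheory.HeatConduction.PhaseSpace N)).tilted (fun x => -(H N) x / T))) =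
            fun t : ℝ => ∫ ω, Real.cos (ω * t) ∂(σ N) := funext (hσ N).2.1
        rw [heq]
        haveI := (hσ N).1
        exact MeasureTheory.continuous_of_dominated (F := fun (t ω : ℝ) => Real.cos (ω * t)) (bound := fun _ => (1 : ℝ))
          (fun t => (Real.continuous_cos.comp (continuous_id.mul continuous_const)).aestronglyMeasurable)
          (fun t => Filter.Eventually.of_forall fun ω => by simpa using Real.abs_cos_le_one (ω * t))
          (MeasureTheory.integrable_const (1 : ℝ))
          (Filter.Eventually.of_forall fun ω => Real.continuous_cos.comp (continuous_const.mul continuous_id))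
      have hbd : ∀ (N : ℕ) (t : ℝ), |∫ x, J N (Φ N t x) * J N x ∂((MeasureTheory.volume : MeasureTheory.Measure (Literature.MathematicalPhysics.KineticTheory.HeatConduction.PhaseSpace N)).tilted (fun x => -(H N) x / T))| ≤
          ∫ x, J N (Φ N 0 x) * J N x ∂((MeasureTheory.volume : MeasureTheory.Measure (Literature.MathematicalPhysics.KineticTheory.HeatConduction.PhaseSpace N)).tilted (fun x => -(H N) x / T)) := by
        intro N t
        rw [(hσ N).2.1 t, (hσ N).2.1 0]
        haveI := (hσ N).1
        have h0 : ∫ ω, Real.cos (ω * 0) ∂(σ N) = (σ N).real Set.univ := by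
          simp [MeasureTheory.integral_const]
        rw [h0]
        have h1 := MeasureTheory.norm_integral_le_of_norm_le_const (μ := σ N) (f := fun ω : ℝ => Real.cos (ω * t)) (C := (1 : ℝ))
          (Filter.Eventually.of_forall fun ω => by simpa using Real.abs_cos_le_one (ω * t))
        simpa [Real.norm_eq_abs] using h1
      have hfull := hGlue (fun (N : ℕ) (t : ℝ) => ∫ x, J N (Φ N t x) * J N x ∂((MeasureTheory.volume : MeasureTheory.Measure (Literature.MathematicalPhysics.KineticTheory.HeatConduction.PhaseSpace N)).tilted (fun x => -(H N) x / T)))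
        D K hcont hbd hD hdrude hreg
      refine ⟨k / T ^ 2, div_pos hk (pow_pos hT 2), ?_⟩
      intro ν hν Dn hDn
      exact hK3 μ γ T k hμ hγ hT H hH J hJ Φ (fun N => (hΦ N).1) ⟨K, hfull, hK⟩ huniq ν hν Dn hDn
    choose k hk using hw
    refine ⟨fun T => if hT : 0 < T then k T hT else 1, ?_, ?_⟩
    · intro T hT
      simp only [dif_pos hT]
      exact (hk T hT).1
    · intro ν hν T hT
      have hresp := hFR μ γ hμ hγ huniq ν hν T hT
      choose Dn hDn using hresp
      refine ⟨Dn, hDn, ?_⟩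
      simp only [dif_pos hT]
      exact (hk T hT).2 ν hν Dn hDn
  show Literature.MathematicalPhysics.KineticTheory.HeatConduction.FouriersLaw
  intro ω₂ lam β γ hω hl hβ hγ
  refine ⟨?_, ?_⟩
  · intro N T_L T_R hL hR
    obtain ⟨μ, hμ⟩ := hEx ω₂ lam β γ hω hl hβ hγ N T_L T_R hL hR
    exact ⟨μ, hμ, fun ν hν => hU ω₂ lam β γ hω hl hβ hγ N T_L T_R hL hR ν μ hν hμ⟩
  · obtain ⟨T₁, hhigh⟩ := hEta ω₂ lam β γ hω hl hβ hγ
      (fun γ' hγ' => hAF (lam / β) γ' (div_pos hl hβ) hγ')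
    have hall := hLow ω₂ lam β γ hω hl hβ hγ ⟨T₁, hhigh⟩
    choose k hk using hall
    refine ⟨fun T => if hT : 0 < T then k T hT else 1, ?_, ?_⟩
    · intro T hT
      simp only [dif_pos hT]
      exact (hk T hT).1
    · intro μ hμ T hT
      obtain ⟨D, hD, hlim⟩ := (hk T hT).2 μ hμ
      refine ⟨D, hD, ?_⟩
      simp only [dif_pos hT]
      exact hlim

end Summit.AtomisticToContinuum.FouriersLaw.Theses.AffineAnchorRing
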